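import Summits.QuantumFields.YangMills.Theorems.LuscherReductionTwistedTraceScalingFloorMass
import Summits.QuantumFields.YangMills.Theorems.LuscherReductionTwistedTraceScalingValleyBOUpperPow
import HarnessLib

/-!
# The k = 0 FLOOR at polynomial scales, part 1: every error exponent of `levelValue_zero_ge_floor` is `O(β^{−1/10})` at
# `τ = β^{−1/3}`, `ρ = β^{−12/25}`, `γ = β^{7/10}`, fixed soft cap `μ` (lane A of S-BASE, crux `TwistedTraceScaling` stmt-QuantumFields-20203;
# design note `pub/ym-fleet/ym-luscher-20007-p1/COARSE-DESIGN.md` §18.4)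

With `u = β^{−1/3}` (tube radius), `v = β^{−12/25}` (chart radius) and `σ = tubeSigma L u`: every small quantity of lane B's chart bookkeeping is `O(u)` and carries
its factor of `ρ = v` explicitly, so the floor's error exponents are sums of the monomials `β u⁴ = β^{−1/3}`, `u`, `β u² v = β^{−11/75}`, `γ u v = β^{−17/150}`,
`γ v² = β^{−13/50}` — all `≤ β^{−1/10}` for `β ≥ 1`:
* §1 rpow toolkit (`scales_basic`: the monomial identities and comparisons);
* §2 `tubeSigma_pow_le`, `sqrt_tubeSigma_pow_le` (`σ ≤ C_σ² u²`);
* §3 `riccatiTrialErr_pow_le` (`E ≤ K β^{−1/10}`), §4 `stepErr_pow_le` (`(β/2)(stepErrUp + chartErr) ≤ K β^{−1/10}`), §5 `floorDefect_pow_le`, §6 `gammaMove_pow_le`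
  (`γ(2uδ₁ + δ₁²) ≤ K β^{−1/10}`) — each with an explicit (if unenlightening) constant depending only on `L` and `μ`.
Part 2 (`…FloorAssembly`) adds the mass and tail bounds and assembles `VacuumFloorAt`.
HONEST FRAMING: real asymptotics for a stub lane of a child of the CONDITIONAL reduction route (femto rung R2b1); not infinite volume, not a gap, not Clay.

## References
* M. Lüscher, Nucl. Phys. B219 (1983) 233, §3. [Luscher1983]
-/

set_option autoImplicit false

noncomputable section

open Real Finset
open scoped BigOperators
open Literature.MathematicalPhysics.QuantumFieldTheory
open Literature.MathematicalPhysics.QuantumLattice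

namespace Summit.QuantumFields.YangMills.Theorems.FemtoTransferGap

open TwoLattice TwoLattice.Toron TwoLattice.Cov TwoLattice.Stiff TwoLattice.Harm TwoLattice.GnChart TwoLattice.Flat

variable {L : ℕ} [NeZero L]

/-! ## §1 The monomials of the scale choice -/

omit [NeZero L] in
/-- **The scale toolkit**: for `β ≥ 1`, `u = β^{−1/3}`, `v = β^{−12/25}`: `0 < v ≤ u ≤ 1`, `v² ≤ u`, and the monomials `β u⁴ = β^{−1/3}`, `β u² v = β^{−11/75}`,
`β^{7/10} u v = β^{−17/150}`, `β^{7/10} v² = β^{−13/50}`, `β^{7/10} u² = β^{1/30}`, `β v² = β^{1/25}`, each of the first four `≤ β^{−1/10}` (as is `u`). [folklore] -/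
theorem scales_basic {β u v : ℝ} (hβ : 1 ≤ β) (hu : u = β ^ (-(1 / 3 : ℝ))) (hv : v = β ^ (-(12 / 25 : ℝ))) :
    0 < u ∧ u ≤ 1 ∧ 0 < v ∧ v ≤ u ∧ v ^ 2 ≤ u ∧
      β * u ^ 4 = β ^ (-(1 / 3 : ℝ)) ∧ β * u ^ 2 * v = β ^ (-(11 / 75 : ℝ)) ∧
      β ^ (7 / 10 : ℝ) * u * v = β ^ (-(17 / 150 : ℝ)) ∧ β ^ (7 / 10 : ℝ) * v ^ 2 = β ^ (-(13 / 50 : ℝ)) ∧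
      β ^ (7 / 10 : ℝ) * u ^ 2 = β ^ (1 / 30 : ℝ) ∧ β * v ^ 2 = β ^ (1 / 25 : ℝ) ∧
      β ^ (-(1 / 3 : ℝ)) ≤ β ^ (-(1 / 10 : ℝ)) ∧ β ^ (-(11 / 75 : ℝ)) ≤ β ^ (-(1 / 10 : ℝ)) ∧
      β ^ (-(17 / 150 : ℝ)) ≤ β ^ (-(1 / 10 : ℝ)) ∧ β ^ (-(13 / 50 : ℝ)) ≤ β ^ (-(1 / 10 : ℝ)) := by
  have hβ0 : 0 < β := by linarith
  have hβ0' : 0 ≤ β := hβ0.le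
  have hpow : ∀ a b : ℝ, β ^ a * β ^ b = β ^ (a + b) := fun a b => (Real.rpow_add hβ0 a b).symm
  have hnat : ∀ (a : ℝ) (k : ℕ), (β ^ a) ^ k = β ^ (a * k) := fun a k => by rw [Real.rpow_mul hβ0', Real.rpow_natCast]
  have hβ1 : β = β ^ (1 : ℝ) := (Real.rpow_one β).symm
  refine ⟨by rw [hu]; exact Real.rpow_pos_of_pos hβ0 _, by rw [hu]; exact Real.rpow_le_one_of_one_le_of_nonpos hβ (by norm_num),
    by rw [hv]; exact Real.rpow_pos_of_pos hβ0 _, ?_, ?_, ?_, ?_, ?_, ?_, ?_, ?_, ?_, ?_, ?_, ?_⟩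
  · rw [hu, hv]; exact Real.rpow_le_rpow_of_exponent_le hβ (by norm_num)
  · rw [hu, hv, hnat]; exact Real.rpow_le_rpow_of_exponent_le hβ (by norm_num)
  · rw [hu, hnat]; nth_rw 1 [hβ1]; rw [hpow]; norm_num
  · rw [hu, hv, hnat]; nth_rw 1 [hβ1]; rw [hpow, hpow]; norm_num
  · rw [hu, hv, hpow, hpow]; norm_num
  · rw [hv, hnat, hpow]; norm_num
  · rw [hu, hnat, hpow]; norm_num
  · rw [hv, hnat]; nth_rw 1 [hβ1]; rw [hpow]; norm_num
  · exact Real.rpow_le_rpow_of_exponent_le hβ (by norm_num)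
  · exact Real.rpow_le_rpow_of_exponent_le hβ (by norm_num)
  · exact Real.rpow_le_rpow_of_exponent_le hβ (by norm_num)
  · exact Real.rpow_le_rpow_of_exponent_le hβ (by norm_num)

/-! ## §2 The tube action level at `τ = β^{−1/3}` -/

/-- `σ(u) ≤ (100N + 729945 N_P)·u²` for `0 ≤ u ≤ 1`. [folklore] -/
theorem tubeSigma_le_sq {u : ℝ} (hu0 : 0 ≤ u) (hu1 : u ≤ 1) :
    tubeSigma L u ≤ (100 * Fintype.card (Plaquette 3 L × Fin 3) + 729945 * Fintype.card (Plaquette 3 L)) * u ^ 2 := by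
  unfold tubeSigma
  rw [mul_pow, mul_pow, Real.sq_sqrt (Nat.cast_nonneg _)]
  have hNP : (0 : ℝ) ≤ Fintype.card (Plaquette 3 L) := Nat.cast_nonneg _
  have h3 : u ^ 3 ≤ u ^ 2 := by nlinarith [pow_nonneg hu0 2]
  have h4 : u ^ 4 ≤ u ^ 2 := by nlinarith [pow_nonneg hu0 2, pow_nonneg hu0 3]
  nlinarith [mul_nonneg hNP (by nlinarith : (0:ℝ) ≤ u ^ 2 - u ^ 3), mul_nonneg hNP (by nlinarith : (0:ℝ) ≤ u ^ 2 - u ^ 4)]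

/-- `√σ(u) ≤ √(100N + 729945 N_P)·u` for `0 ≤ u ≤ 1`. [folklore] -/
theorem sqrt_tubeSigma_le {u : ℝ} (hu0 : 0 ≤ u) (hu1 : u ≤ 1) :
    Real.sqrt (tubeSigma L u) ≤ Real.sqrt (100 * Fintype.card (Plaquette 3 L × Fin 3) + 729945 * Fintype.card (Plaquette 3 L)) * u := by
  have h := tubeSigma_le_sq (L := L) hu0 hu1
  calc Real.sqrt (tubeSigma L u) ≤ Real.sqrt ((100 * Fintype.card (Plaquette 3 L × Fin 3) + 729945 * Fintype.card (Plaquette 3 L)) * u ^ 2) :=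
        Real.sqrt_le_sqrt h
    _ = _ := by rw [Real.sqrt_mul (by positivity), Real.sqrt_sq hu0]

/-! ## §3 Lane B's chart quantities at the scales: everything is `O(u)` with its factor of `v` explicit -/

/-- The chart bookkeeping at the scales: with `C_σ = √(100N + 729945N_P)`, for `0 < v ≤ u ≤ 1`:
`√σ(u) ≤ C_σ u` and `stepRem v σ(u) ≤ (720 + 66C_σ)·u·v`. [folklore] -/
theorem chart_quantities_le {u v : ℝ} (hu0 : 0 < u) (hu1 : u ≤ 1) (hv0 : 0 < v) (hvu : v ≤ u) :
    Real.sqrt (tubeSigma L u) ≤ Real.sqrt (100 * Fintype.card (Plaquette 3 L × Fin 3) + 729945 * Fintype.card (Plaquette 3 L)) * u ∧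
    stepRem v (tubeSigma L u) ≤ (720 + 66 * Real.sqrt (100 * Fintype.card (Plaquette 3 L × Fin 3) + 729945 * Fintype.card (Plaquette 3 L))) * u * v := by
  have h1 := sqrt_tubeSigma_le (L := L) hu0.le hu1
  refine ⟨h1, ?_⟩
  unfold stepRem
  have h2 : v ^ 2 ≤ u * v := by nlinarith
  have h3 : 66 * v * Real.sqrt (tubeSigma L u) ≤
      66 * v * (Real.sqrt (100 * Fintype.card (Plaquette 3 L × Fin 3) + 729945 * Fintype.card (Plaquette 3 L)) * u) :=
    mul_le_mul_of_nonneg_left h1 (by positivity)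
  nlinarith

/-! ## §4 Abstract algebra of the three error budgets (all atoms as variables) -/

/-- The constant of the trial-exponent error bound. [folklore] -/
def kTrial (sN sn cg cL μ Cσ : ℝ) : ℝ :=
  504 * sN * (20 * sN) * (cL * sn * (10 * sN) ^ 2 + cg / μ) * (Cσ + 10 * sN + (sN * (720 + 66 * Cσ) + 5 * sN)) ^ 2 +
    cg * (sN * (720 + 66 * Cσ) + 5 * sN) * ((Cσ + 10 * sN + (sN * (720 + 66 * Cσ) + 5 * sN)) + (Cσ + 10 * sN))

/-- ★ **Abstract trial-exponent budget**: with `A₂ = s_σ + 10 v s_N`, `d = s_N r + 5v³ s_N`, `0 ≤ s_σ ≤ C_σ u`, `0 ≤ r ≤ (720+66C_σ)uv`, `0 < v ≤ u ≤ 1`, `v² ≤ u`: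
`504 v s_N (20 s_N)(β c_L s_n (10s_N)² + β c_g/μ) A₁² + β c_g d (A₁ + A₂) ≤ kTrial · (β u² v)`. [folklore] -/
theorem trialErr_abstract_le {β u v sσ r sN sn cg cL μ Cσ : ℝ} (hβ : 0 ≤ β) (hu0 : 0 < u) (hu1 : u ≤ 1) (hv0 : 0 < v) (hvu : v ≤ u) (hv2 : v ^ 2 ≤ u)
    (hsN : 0 ≤ sN) (hsn : 0 ≤ sn) (hcg : 0 ≤ cg) (hcL : 0 ≤ cL) (hμ : 0 < μ) (hCσ : 0 ≤ Cσ) (hsσ0 : 0 ≤ sσ) (hsσ : sσ ≤ Cσ * u) (hr0 : 0 ≤ r)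
    (hr : r ≤ (720 + 66 * Cσ) * u * v) :
    504 * v * sN * (10 * sN + 10 * sN) * (β * cL * sn * (10 * sN) ^ 2 + β * cg / μ) * (sσ + 10 * v * sN + (sN * r + 5 * v ^ 3 * sN)) ^ 2 +
        β * cg * (sN * r + 5 * v ^ 3 * sN) * ((sσ + 10 * v * sN + (sN * r + 5 * v ^ 3 * sN)) + (sσ + 10 * v * sN)) ≤
      kTrial sN sn cg cL μ Cσ * (β * u ^ 2 * v) := by
  set C₂ : ℝ := Cσ + 10 * sN with hC₂
  set Cd : ℝ := sN * (720 + 66 * Cσ) + 5 * sN with hCd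
  set A₂ : ℝ := sσ + 10 * v * sN with hA₂
  set d : ℝ := sN * r + 5 * v ^ 3 * sN with hd
  have hv1 : v ≤ 1 := hvu.trans hu1
  have hC₂0 : 0 ≤ C₂ := by positivity
  have hCd0 : 0 ≤ Cd := by positivity
  have hA₂0 : 0 ≤ A₂ := by positivity
  have hd0 : 0 ≤ d := by positivity
  have hA₂' : A₂ ≤ C₂ * u := by
    have h := mul_le_mul_of_nonneg_left hvu (show (0:ℝ) ≤ 10 * sN by positivity)
    rw [hA₂, hC₂]; linarith
  have hv3 : v ^ 3 ≤ u * v := by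
    have h := mul_le_mul_of_nonneg_right hv2 hv0.le
    calc v ^ 3 = v ^ 2 * v := by ring
      _ ≤ u * v := h
  have hd' : d ≤ Cd * (u * v) := by
    rw [hd, hCd]
    have h5 : sN * r ≤ sN * ((720 + 66 * Cσ) * u * v) := mul_le_mul_of_nonneg_left hr hsN
    have h6 : 5 * v ^ 3 * sN ≤ 5 * (u * v) * sN := by
      have := mul_le_mul_of_nonneg_right hv3 hsN
      linarith
    linarith
  have huv : u * v ≤ u := by
    have := mul_le_mul_of_nonneg_left hv1 hu0.le
    linarith
  have hdu : d ≤ Cd * u := hd'.trans (mul_le_mul_of_nonneg_left huv hCd0)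
  have hA₁ : A₂ + d ≤ (C₂ + Cd) * u := by linarith
  have hA₁0 : 0 ≤ A₂ + d := by positivity
  have hK : kTrial sN sn cg cL μ Cσ = 504 * sN * (20 * sN) * (cL * sn * (10 * sN) ^ 2 + cg / μ) * (C₂ + Cd) ^ 2 + cg * Cd * ((C₂ + Cd) + C₂) := by
    rw [kTrial, hC₂, hCd]
  -- first term
  have hsq : (A₂ + d) ^ 2 ≤ ((C₂ + Cd) * u) ^ 2 := pow_le_pow_left₀ hA₁0 hA₁ 2
  have h1 : 504 * v * sN * (10 * sN + 10 * sN) * (β * cL * sn * (10 * sN) ^ 2 + β * cg / μ) * (A₂ + d) ^ 2 ≤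
      504 * sN * (20 * sN) * (cL * sn * (10 * sN) ^ 2 + cg / μ) * (C₂ + Cd) ^ 2 * (β * u ^ 2 * v) := by
    have hpre : 0 ≤ 504 * v * sN * (10 * sN + 10 * sN) * (β * cL * sn * (10 * sN) ^ 2 + β * cg / μ) := by positivity
    calc _ ≤ 504 * v * sN * (10 * sN + 10 * sN) * (β * cL * sn * (10 * sN) ^ 2 + β * cg / μ) * ((C₂ + Cd) * u) ^ 2 :=
          mul_le_mul_of_nonneg_left hsq hpre
      _ = _ := by field_simp; ring
  -- second term
  have h2 : β * cg * d * ((A₂ + d) + A₂) ≤ cg * Cd * ((C₂ + Cd) + C₂) * (β * u ^ 2 * v) := by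
    have h3 : (A₂ + d) + A₂ ≤ ((C₂ + Cd) + C₂) * u := by linarith
    calc β * cg * d * ((A₂ + d) + A₂) ≤ β * cg * (Cd * (u * v)) * (((C₂ + Cd) + C₂) * u) :=
          mul_le_mul (mul_le_mul_of_nonneg_left hd' (by positivity)) h3 (by positivity) (by positivity)
      _ = _ := by ring
  rw [hK]
  calc _ ≤ 504 * sN * (20 * sN) * (cL * sn * (10 * sN) ^ 2 + cg / μ) * (C₂ + Cd) ^ 2 * (β * u ^ 2 * v) +
        cg * Cd * ((C₂ + Cd) + C₂) * (β * u ^ 2 * v) := add_le_add h1 h2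
    _ = _ := by ring

/-- The constants of the action-error bound. [folklore] -/
def kStep₁ (sN Cσ : ℝ) : ℝ := (Cσ + 10 * sN) * (sN * (720 + 66 * Cσ)) + (sN * (720 + 66 * Cσ)) ^ 2 / 2 + 5 * sN * (Cσ + 10 * sN)

/-- (continued) [folklore] -/
def kStep₂ (sN Cσ : ℝ) : ℝ := ((Cσ + 10 * sN) + sN * (720 + 66 * Cσ)) ^ 4 / 2

/-- ★ **Abstract action-error budget**: `(β/2)(η₂ + θ)` with `η₂ = 2A₂(s_N r) + (s_N r)² + (A₂ + s_N r)⁴`, `θ = 10 v³ s_N A₂` is at most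
`kStep₁·(βu²v) + kStep₂·(βu⁴)`. [folklore] -/
theorem stepErr_abstract_le {β u v sσ r sN Cσ : ℝ} (hβ : 0 ≤ β) (hu0 : 0 < u) (hu1 : u ≤ 1) (hv0 : 0 < v) (hvu : v ≤ u) (hv2 : v ^ 2 ≤ u)
    (hsN : 0 ≤ sN) (hCσ : 0 ≤ Cσ) (hsσ0 : 0 ≤ sσ) (hsσ : sσ ≤ Cσ * u) (hr0 : 0 ≤ r) (hr : r ≤ (720 + 66 * Cσ) * u * v) :
    β / 2 * ((2 * (sσ + 10 * v * sN) * (sN * r) + (sN * r) ^ 2 + (sσ + 10 * v * sN + sN * r) ^ 4) + 10 * v ^ 3 * sN * (sσ + 10 * v * sN)) ≤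
      kStep₁ sN Cσ * (β * u ^ 2 * v) + kStep₂ sN Cσ * (β * u ^ 4) := by
  set C₂ : ℝ := Cσ + 10 * sN with hC₂
  set Cr : ℝ := 720 + 66 * Cσ with hCr
  set A₂ : ℝ := sσ + 10 * v * sN with hA₂
  have hv1 : v ≤ 1 := hvu.trans hu1
  have hC₂0 : 0 ≤ C₂ := by positivity
  have hCr0 : 0 ≤ Cr := by positivity
  have hA₂0 : 0 ≤ A₂ := by positivity
  have hA₂' : A₂ ≤ C₂ * u := by
    have h := mul_le_mul_of_nonneg_left hvu (show (0:ℝ) ≤ 10 * sN by positivity)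
    rw [hA₂, hC₂]; linarith
  have hr' : r ≤ Cr * u * v := by rw [hCr]; exact hr
  have hruv : r ≤ Cr * u := by
    have h := mul_le_mul_of_nonneg_left hv1 (mul_nonneg hCr0 hu0.le)
    linarith
  have hK₁ : kStep₁ sN Cσ = C₂ * (sN * Cr) + (sN * Cr) ^ 2 / 2 + 5 * sN * C₂ := by rw [kStep₁, hC₂, hCr]
  have hK₂ : kStep₂ sN Cσ = (C₂ + sN * Cr) ^ 4 / 2 := by rw [kStep₂, hC₂, hCr]
  have hexp : β / 2 * ((2 * A₂ * (sN * r) + (sN * r) ^ 2 + (A₂ + sN * r) ^ 4) + 10 * v ^ 3 * sN * A₂) =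
      β * A₂ * (sN * r) + β / 2 * (sN * r) ^ 2 + β / 2 * (A₂ + sN * r) ^ 4 + β * (5 * v ^ 3 * sN * A₂) := by ring
  rw [hexp]
  have h1 : β * A₂ * (sN * r) ≤ C₂ * (sN * Cr) * (β * u ^ 2 * v) := by
    calc β * A₂ * (sN * r) ≤ β * (C₂ * u) * (sN * (Cr * u * v)) :=
          mul_le_mul (mul_le_mul_of_nonneg_left hA₂' hβ) (mul_le_mul_of_nonneg_left hr' hsN) (by positivity) (by positivity)
      _ = _ := by ring
  have h2 : β / 2 * (sN * r) ^ 2 ≤ (sN * Cr) ^ 2 / 2 * (β * u ^ 2 * v) := by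
    have h3 : (sN * r) ^ 2 ≤ (sN * (Cr * u * v)) ^ 2 := pow_le_pow_left₀ (by positivity) (mul_le_mul_of_nonneg_left hr' hsN) 2
    have h4 : (u * v) ^ 2 ≤ u ^ 2 * v := by
      have hvv : v ^ 2 ≤ v := by
        have := mul_le_mul_of_nonneg_left hv1 hv0.le
        calc v ^ 2 = v * v := by ring
          _ ≤ v * 1 := this
          _ = v := mul_one v
      have := mul_le_mul_of_nonneg_left hvv (pow_nonneg hu0.le 2)
      calc (u * v) ^ 2 = u ^ 2 * v ^ 2 := by ring
        _ ≤ u ^ 2 * v := this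
    calc β / 2 * (sN * r) ^ 2 ≤ β / 2 * (sN * (Cr * u * v)) ^ 2 := mul_le_mul_of_nonneg_left h3 (by positivity)
      _ = (sN * Cr) ^ 2 / 2 * (β * (u * v) ^ 2) := by ring
      _ ≤ (sN * Cr) ^ 2 / 2 * (β * (u ^ 2 * v)) := by gcongr
      _ = _ := by ring
  have h3 : β / 2 * (A₂ + sN * r) ^ 4 ≤ (C₂ + sN * Cr) ^ 4 / 2 * (β * u ^ 4) := by
    have h4 : A₂ + sN * r ≤ (C₂ + sN * Cr) * u := by
      have := mul_le_mul_of_nonneg_left hruv hsN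
      linarith
    have h5 : (A₂ + sN * r) ^ 4 ≤ ((C₂ + sN * Cr) * u) ^ 4 := pow_le_pow_left₀ (by positivity) h4 4
    calc β / 2 * (A₂ + sN * r) ^ 4 ≤ β / 2 * ((C₂ + sN * Cr) * u) ^ 4 := mul_le_mul_of_nonneg_left h5 (by positivity)
      _ = _ := by ring
  have h4 : β * (5 * v ^ 3 * sN * A₂) ≤ 5 * sN * C₂ * (β * u ^ 2 * v) := by
    have hv3 : v ^ 3 ≤ u * v := by
      have h := mul_le_mul_of_nonneg_right hv2 hv0.le
      calc v ^ 3 = v ^ 2 * v := by ring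
        _ ≤ u * v := h
    have h5 : v ^ 3 * A₂ ≤ (u * v) * (C₂ * u) := mul_le_mul hv3 hA₂' hA₂0 (by positivity)
    calc β * (5 * v ^ 3 * sN * A₂) = β * (5 * sN) * (v ^ 3 * A₂) := by ring
      _ ≤ β * (5 * sN) * ((u * v) * (C₂ * u)) := mul_le_mul_of_nonneg_left h5 (by positivity)
      _ = _ := by ring
  rw [hK₁, hK₂]
  calc _ ≤ C₂ * (sN * Cr) * (β * u ^ 2 * v) + (sN * Cr) ^ 2 / 2 * (β * u ^ 2 * v) + (C₂ + sN * Cr) ^ 4 / 2 * (β * u ^ 4) +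
        5 * sN * C₂ * (β * u ^ 2 * v) := add_le_add (add_le_add (add_le_add h1 h2) h3) h4
    _ = _ := by ring

/-! ## §5 The three budgets at the scales -/

/-- `√((β/2)² + 2(β/2)β/μ) = β·√(1/4 + 1/μ)` (`β ≥ 0`, `μ > 0`). [folklore] -/
theorem sqrt_riccati_const {β μ : ℝ} (hβ : 0 ≤ β) (hμ : 0 < μ) :
    Real.sqrt ((β / 2) ^ 2 + 2 * (β / 2) * β / μ) = β * Real.sqrt (1 / 4 + 1 / μ) := by
  have h : (β / 2) ^ 2 + 2 * (β / 2) * β / μ = (1 / 4 + 1 / μ) * β ^ 2 := by field_simp; ring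
  rw [h, Real.sqrt_mul' _ (sq_nonneg β), Real.sqrt_sq hβ, mul_comm]

/-- ★ `riccatiTrialErr L β μ (β^{−12/25}) (σ(β^{−1/3})) ≤ K·β^{−1/10}` for `β ≥ 1` (`μ > 0`). [cite: Luscher1983, §3] -/
theorem riccatiTrialErr_pow_le {μ : ℝ} (hμ : 0 < μ) : ∃ K : ℝ, 0 ≤ K ∧ ∀ β : ℝ, 1 ≤ β →
    riccatiTrialErr L β μ (β ^ (-(12 / 25 : ℝ))) (tubeSigma L (β ^ (-(1 / 3 : ℝ)))) ≤ K * β ^ (-(1 / 10 : ℝ)) := by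
  refine ⟨kTrial (Real.sqrt (Fintype.card (Plaquette 3 L × Fin 3))) (Real.sqrt (Fintype.card (Edge 3 L × Fin 3))) (Real.sqrt (1 / 4 + 1 / μ))
      (3 / 2 / μ ^ 2 + 3 / μ ^ 3) μ (Real.sqrt (100 * Fintype.card (Plaquette 3 L × Fin 3) + 729945 * Fintype.card (Plaquette 3 L))),
    by unfold kTrial; positivity, fun β hβ => ?_⟩
  have hβ0 : 0 < β := by linarith
  obtain ⟨hu0, hu1, hv0, hvu, hv2, -, hM1, -, -, -, -, -, hle1, -⟩ := scales_basic hβ (u := β ^ (-(1 / 3 : ℝ))) (v := β ^ (-(12 / 25 : ℝ))) rfl rfl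
  obtain ⟨hsσ, hrem⟩ := chart_quantities_le (L := L) hu0 hu1 hv0 hvu
  have hLip : 3 * (β / 2) / μ ^ 2 + 3 * β / μ ^ 3 = β * (3 / 2 / μ ^ 2 + 3 / μ ^ 3) := by ring
  rw [riccatiTrialErr, trialErr, sqrt_riccati_const hβ0.le hμ, hLip]
  have h := trialErr_abstract_le (sN := Real.sqrt (Fintype.card (Plaquette 3 L × Fin 3))) (sn := Real.sqrt (Fintype.card (Edge 3 L × Fin 3)))
    (cg := Real.sqrt (1 / 4 + 1 / μ)) (cL := 3 / 2 / μ ^ 2 + 3 / μ ^ 3) hβ0.le hu0 hu1 hv0 hvu hv2 (Real.sqrt_nonneg _) (Real.sqrt_nonneg _)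
    (Real.sqrt_nonneg _) (by positivity) hμ (Real.sqrt_nonneg _) (Real.sqrt_nonneg _) hsσ (by unfold stepRem; positivity) hrem
  rw [hM1] at h
  refine h.trans (mul_le_mul_of_nonneg_left hle1 (by unfold kTrial; positivity))

/-- ★ `(β/2)·(stepErrUp + chartErr)(β^{−12/25}, σ(β^{−1/3})) ≤ K·β^{−1/10}` for `β ≥ 1`. [cite: Luscher1983, §3] -/
theorem stepErr_pow_le : ∃ K : ℝ, 0 ≤ K ∧ ∀ β : ℝ, 1 ≤ β →
    β / 2 * (stepErrUp (β ^ (-(12 / 25 : ℝ))) (tubeSigma L (β ^ (-(1 / 3 : ℝ)))) (Fintype.card (Plaquette 3 L × Fin 3)) +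
      chartErr (β ^ (-(12 / 25 : ℝ))) (tubeSigma L (β ^ (-(1 / 3 : ℝ)))) (Fintype.card (Plaquette 3 L × Fin 3))) ≤ K * β ^ (-(1 / 10 : ℝ)) := by
  refine ⟨kStep₁ (Real.sqrt (Fintype.card (Plaquette 3 L × Fin 3))) (Real.sqrt (100 * Fintype.card (Plaquette 3 L × Fin 3) + 729945 * Fintype.card (Plaquette 3 L))) +
      kStep₂ (Real.sqrt (Fintype.card (Plaquette 3 L × Fin 3))) (Real.sqrt (100 * Fintype.card (Plaquette 3 L × Fin 3) + 729945 * Fintype.card (Plaquette 3 L))),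
    by unfold kStep₁ kStep₂; positivity, fun β hβ => ?_⟩
  have hβ0 : 0 < β := by linarith
  obtain ⟨hu0, hu1, hv0, hvu, hv2, hM0, hM1, -, -, -, -, hle0, hle1, -⟩ := scales_basic hβ (u := β ^ (-(1 / 3 : ℝ))) (v := β ^ (-(12 / 25 : ℝ))) rfl rfl
  obtain ⟨hsσ, hrem⟩ := chart_quantities_le (L := L) hu0 hu1 hv0 hvu
  have hsσ0 : 0 ≤ Real.sqrt (tubeSigma L (β ^ (-(1 / 3 : ℝ)))) := Real.sqrt_nonneg _
  have hrem0 : 0 ≤ stepRem (β ^ (-(12 / 25 : ℝ))) (tubeSigma L (β ^ (-(1 / 3 : ℝ)))) := by unfold stepRem; positivity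
  have hsN0 : 0 ≤ Real.sqrt (Fintype.card (Plaquette 3 L × Fin 3) : ℝ) := Real.sqrt_nonneg _
  have hCσ0 : 0 ≤ Real.sqrt (100 * Fintype.card (Plaquette 3 L × Fin 3) + 729945 * Fintype.card (Plaquette 3 L) : ℝ) := Real.sqrt_nonneg _
  rw [stepErrUp, stepErrLo, chartErr]
  -- atoms
  generalize hgs : Real.sqrt (tubeSigma L (β ^ (-(1 / 3 : ℝ)))) = sσ at hsσ hsσ0 ⊢
  generalize hgr : stepRem (β ^ (-(12 / 25 : ℝ))) (tubeSigma L (β ^ (-(1 / 3 : ℝ)))) = r at hrem hrem0 ⊢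
  generalize hgu : β ^ (-(1 / 3 : ℝ)) = u at hu0 hu1 hvu hv2 hM0 hM1 hle0 hsσ hrem ⊢
  generalize hgv : β ^ (-(12 / 25 : ℝ)) = v at hv0 hvu hv2 hM1 hrem ⊢
  generalize hgN : Real.sqrt (Fintype.card (Plaquette 3 L × Fin 3) : ℝ) = sN at hsN0 ⊢
  generalize hgC : Real.sqrt (100 * Fintype.card (Plaquette 3 L × Fin 3) + 729945 * Fintype.card (Plaquette 3 L) : ℝ) = Cσ at hCσ0 hsσ hrem ⊢
  have h := stepErr_abstract_le hβ0.le hu0 hu1 hv0 hvu hv2 hsN0 hCσ0 hsσ0 hsσ hrem0 hrem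
  have heq : β / 2 * (2 * (sσ + 10 * v * sN) * (sN * r) + (sN * r) ^ 2 + (sσ + 10 * v * sN + sN * r) ^ 4 + 10 * v ^ 3 * sN * (sσ + 10 * v * sN)) =
      β / 2 * ((2 * (sσ + 10 * v * sN) * (sN * r) + (sN * r) ^ 2 + (sσ + 10 * v * sN + sN * r) ^ 4) + 10 * v ^ 3 * sN * (sσ + 10 * v * sN)) := by ring
  rw [heq]
  refine h.trans ?_
  rw [hM0, hM1]
  have hk1 : 0 ≤ kStep₁ sN Cσ := by unfold kStep₁; positivity
  have hk2 : 0 ≤ kStep₂ sN Cσ := by unfold kStep₂; positivity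
  calc kStep₁ sN Cσ * β ^ (-(11 / 75 : ℝ)) + kStep₂ sN Cσ * u
      ≤ kStep₁ sN Cσ * β ^ (-(1 / 10 : ℝ)) + kStep₂ sN Cσ * β ^ (-(1 / 10 : ℝ)) := by gcongr
    _ = _ := by ring

/-- ★ `floorDefect L β μ (β^{−1/3}) ≤ K·β^{−1/10}` for `β ≥ 1` (`μ > 0`). [cite: Luscher1983, §3] -/
theorem floorDefect_pow_le {μ : ℝ} (hμ : 0 < μ) : ∃ K : ℝ, 0 ≤ K ∧ ∀ β : ℝ, 1 ≤ β →
    floorDefect L β μ (β ^ (-(1 / 3 : ℝ))) ≤ K * β ^ (-(1 / 10 : ℝ)) := by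
  refine ⟨(Fintype.card (Plaquette 3 L) : ℝ) * 837 ^ 2 / 2 +
      (288 * Real.sqrt (Fintype.card (Plaquette 3 L × Fin 3)) + 504 * Real.sqrt (Fintype.card (Plaquette 3 L × Fin 3)) * Real.sqrt (Fintype.card (Edge 3 L × Fin 3))) ^ 2 +
      ((Fintype.card (Edge 3 L) * 3 : ℕ) : ℝ) * ((1 / 2 + Real.sqrt (1 / 4 + 1 / μ)) / 2 * (2 * (504 * Real.sqrt (Fintype.card (Plaquette 3 L × Fin 3))) ^ 2)) +
      ((Fintype.card (Edge 3 L) * 3 : ℕ) : ℝ) * (Real.sqrt (1 / 2 / 2) * (504 * Real.sqrt (Fintype.card (Plaquette 3 L × Fin 3)))) +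
      2 * (1 + μ / 4) * (2 * (504 * Real.sqrt (Fintype.card (Plaquette 3 L × Fin 3))) ^ 2 * Real.sqrt (Fintype.card (Edge 3 L × Fin 3)) ^ 2 +
        (288 * Real.sqrt (Fintype.card (Plaquette 3 L × Fin 3)) + 504 * Real.sqrt (Fintype.card (Plaquette 3 L × Fin 3)) * Real.sqrt (Fintype.card (Edge 3 L × Fin 3))) ^ 2),
    by positivity, fun β hβ => ?_⟩
  have hβ0 : 0 < β := by linarith
  obtain ⟨hu0, hu1, -, -, -, hM0, -, -, -, -, -, hle0, -, -⟩ := scales_basic hβ (u := β ^ (-(1 / 3 : ℝ))) (v := β ^ (-(12 / 25 : ℝ))) rfl rfl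
  have hsN0 : 0 ≤ Real.sqrt (Fintype.card (Plaquette 3 L × Fin 3) : ℝ) := Real.sqrt_nonneg _
  have hsn0 : 0 ≤ Real.sqrt (Fintype.card (Edge 3 L × Fin 3) : ℝ) := Real.sqrt_nonneg _
  have hcg0 : 0 ≤ Real.sqrt (1 / 4 + 1 / μ) := Real.sqrt_nonneg _
  have hNP0 : (0 : ℝ) ≤ (Fintype.card (Plaquette 3 L) : ℝ) := Nat.cast_nonneg _
  have hn30 : (0 : ℝ) ≤ ((Fintype.card (Edge 3 L) * 3 : ℕ) : ℝ) := Nat.cast_nonneg _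
  rw [floorDefect, sqrt_riccati_const hβ0.le hμ]
  have hcs : ((β / 2) + β * Real.sqrt (1 / 4 + 1 / μ)) / (2 * β) = (1 / 2 + Real.sqrt (1 / 4 + 1 / μ)) / 2 := by
    field_simp
  have ha : 2 * (β / 2) + (β / 2) ^ 2 * μ / β = β * (1 + μ / 4) := by
    field_simp
    ring
  rw [hcs, ha]
  -- atoms
  generalize hgu : β ^ (-(1 / 3 : ℝ)) = u at hu0 hu1 hM0 hle0 ⊢
  generalize hgN : Real.sqrt (Fintype.card (Plaquette 3 L × Fin 3) : ℝ) = sN at hsN0 ⊢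
  generalize hgn : Real.sqrt (Fintype.card (Edge 3 L × Fin 3) : ℝ) = sn at hsn0 ⊢
  generalize hgc : Real.sqrt (1 / 4 + 1 / μ) = cg at hcg0 ⊢
  generalize hgP : (Fintype.card (Plaquette 3 L) : ℝ) = NP at hNP0 ⊢
  generalize hg3 : ((Fintype.card (Edge 3 L) * 3 : ℕ) : ℝ) = n3 at hn30 ⊢
  have hu2 : u ^ 2 ≤ u := by
    have := mul_le_mul_of_nonneg_left hu1 hu0.le
    calc u ^ 2 = u * u := by ring
      _ ≤ u * 1 := this
      _ = u := mul_one u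
  have hule : u ≤ β ^ (-(1 / 10 : ℝ)) := hle0
  have hu2le : u ^ 2 ≤ β ^ (-(1 / 10 : ℝ)) := hu2.trans hule
  have hβu4 : β * u ^ 4 ≤ β ^ (-(1 / 10 : ℝ)) := by rw [hM0]; exact hle0
  have heq : β / 2 * (NP * (837 * u ^ 2) ^ 2) + β * (288 * u ^ 2 * sN + 504 * u * sN * (u * sn)) ^ 2 +
        n3 * ((1 / 2 + cg) / 2 * (2 * (504 * u * sN) ^ 2)) + n3 * (Real.sqrt (1 / 2 / 2) * (504 * u * sN)) +
        2 * (β * (1 + μ / 4)) * (2 * (504 * u * sN) ^ 2 * (u * sn) ^ 2 + (288 * u ^ 2 * sN + 504 * u * sN * (u * sn)) ^ 2) =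
      NP * 837 ^ 2 / 2 * (β * u ^ 4) + (288 * sN + 504 * sN * sn) ^ 2 * (β * u ^ 4) +
        n3 * ((1 / 2 + cg) / 2 * (2 * (504 * sN) ^ 2)) * u ^ 2 + n3 * (Real.sqrt (1 / 2 / 2) * (504 * sN)) * u +
        2 * (1 + μ / 4) * (2 * (504 * sN) ^ 2 * sn ^ 2 + (288 * sN + 504 * sN * sn) ^ 2) * (β * u ^ 4) := by ring
  rw [heq]
  have h5 : 0 ≤ 2 * (1 + μ / 4) * (2 * (504 * sN) ^ 2 * sn ^ 2 + (288 * sN + 504 * sN * sn) ^ 2) := by positivity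
  calc _ ≤ NP * 837 ^ 2 / 2 * β ^ (-(1 / 10 : ℝ)) + (288 * sN + 504 * sN * sn) ^ 2 * β ^ (-(1 / 10 : ℝ)) +
        n3 * ((1 / 2 + cg) / 2 * (2 * (504 * sN) ^ 2)) * β ^ (-(1 / 10 : ℝ)) + n3 * (Real.sqrt (1 / 2 / 2) * (504 * sN)) * β ^ (-(1 / 10 : ℝ)) +
        2 * (1 + μ / 4) * (2 * (504 * sN) ^ 2 * sn ^ 2 + (288 * sN + 504 * sN * sn) ^ 2) * β ^ (-(1 / 10 : ℝ)) := by
        gcongr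
    _ = _ := by ring

/-! ## §6 The cut-off's change along a chart step at the scales -/

/-- ★ `γ·(2τ·δ₁ + δ₁²) ≤ K·β^{−1/10}` at `γ = β^{7/10}`, `τ = β^{−1/3}`, `δ₁ = chartMove L (β^{−12/25})`, for `β ≥ 1`. [folklore] -/
theorem gammaMove_pow_le : ∃ K : ℝ, 0 ≤ K ∧ ∀ β : ℝ, 1 ≤ β →
    β ^ (7 / 10 : ℝ) * (2 * β ^ (-(1 / 3 : ℝ)) * chartMove L (β ^ (-(12 / 25 : ℝ))) + chartMove L (β ^ (-(12 / 25 : ℝ))) ^ 2) ≤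
      K * β ^ (-(1 / 10 : ℝ)) := by
  set nE : ℝ := (Fintype.card (Edge 3 L) : ℝ) with hnE
  have hnE0 : 0 ≤ nE := Nat.cast_nonneg _
  refine ⟨2 * (nE * Real.sqrt 2) + (nE * Real.sqrt 2) ^ 2, by positivity, fun β hβ => ?_⟩
  obtain ⟨-, -, -, -, -, -, -, hM2, hM3, -, -, -, -, hle2, hle3⟩ := scales_basic hβ (u := β ^ (-(1 / 3 : ℝ))) (v := β ^ (-(12 / 25 : ℝ))) rfl rfl
  have hcm : chartMove L (β ^ (-(12 / 25 : ℝ))) = nE * Real.sqrt 2 * β ^ (-(12 / 25 : ℝ)) := by rw [chartMove, hnE]; ring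
  rw [hcm]
  have heq : β ^ (7 / 10 : ℝ) * (2 * β ^ (-(1 / 3 : ℝ)) * (nE * Real.sqrt 2 * β ^ (-(12 / 25 : ℝ))) + (nE * Real.sqrt 2 * β ^ (-(12 / 25 : ℝ))) ^ 2) =
      2 * (nE * Real.sqrt 2) * (β ^ (7 / 10 : ℝ) * β ^ (-(1 / 3 : ℝ)) * β ^ (-(12 / 25 : ℝ))) +
        (nE * Real.sqrt 2) ^ 2 * (β ^ (7 / 10 : ℝ) * (β ^ (-(12 / 25 : ℝ))) ^ 2) := by ring
  rw [heq, hM2, hM3]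
  calc _ ≤ 2 * (nE * Real.sqrt 2) * β ^ (-(1 / 10 : ℝ)) + (nE * Real.sqrt 2) ^ 2 * β ^ (-(1 / 10 : ℝ)) := by gcongr
    _ = _ := by ring

end Summit.QuantumFields.YangMills.Theorems.FemtoTransferGap

end
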